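import Literature.IUT.HodgeTheaters.Cor53RigidOverBaseOfRatioRigidity
import HarnessLib

/-!
# [EtTh] Def. 3.6 tempered Frobenioids: `RigidOverBase` (= [IUTchI] Cor 5.3 (iv) injectivity content, as typed by abc-iut-L5)
# from ONE displayed rigidity Prop on the DATA `(Φ, B, Div_B)` — «every natural automorphism of the data over `id_D` is trivial»

S. Mochizuki, *The étale theta function …*, Publ. RIMS **45** (2009) [MochizukiEtTh2009], Def. 3.6 pp.302–303 (PDF pp.76–77): the tempered
Frobenioid is «the model Frobenioid determined by the data `(D, Φ, B, B → Φ^gp)` [cf. [FrdI], Theorem 5.2, (ii)]»; §5 Thm. 5.6 (cyclotomic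
rigidity) / Prop. 5.3 / Prop. 3.2 (iii) are the inputs print uses (steps S3–S5 of [IUTchI] Cor. 5.3 (iv), p.144) to see that a self-equivalence
`α` over the identity of the base «induces the identity on the rational function and divisor monoids». [cite: MochizukiEtTh2009, Def 3.6 p.303 (PDF p.77)]
S. Mochizuki, *The geometry of Frobenioids I* (2008) [MochizukiFrdI2008], Thm. 4.2 / Thm. 4.9 / Cor. 4.11 (category-theoreticity of the
divisor monoid and of the rational functions), Thm. 5.2 (model Frobenioids). [cite: MochizukiFrdI2008, Thm. 5.2 p.100]

abc-iut cell, layer L2 = [EtTh], seat abc-iut-L2-t12 (gen 12), KEY «COR53IV-HRAT@THETA-FROBENIOID» lane 1 — POSITIVE (R2) BUILD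
(abc-iut-L2-lead gen 9 R1439/R1444 on this seat's census `COR53IV-HRAT-CENSUS.md`; binder shape (R2) chosen by abc-iut-L5-lead).
CONSUMER: abc-iut-L5-t4's ★ p516053 `Cor53.tempered_rigidOverBase_of_divRatioRigid (C : TemperedFrobenioid T D VD) … (hrat : …)` — this file
PRODUCES its law `hrat` (verbatim) from TWO displayed FACT-SHAPE Props on the Def. 3.6 data, and nothing else:
* **`TemperedFrobenioid.DataAut C`** — an automorphism of the DATA over `id_D`: natural monoid automorphisms `a_A : Φ(A) ≃ Φ(A)`,
  `b_A : B(A) ≃ B(A)` (natural w.r.t. every pull-back `Φ(f)`, `B(f)`) with `Div_B ∘ b = a^gp ∘ Div_B`;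
* **`TemperedFrobenioid.SelfEquivInducesDataAut C`** ([FrdI] Thm. 4.2 / Thm. 4.9 / Cor. 4.11 SHAPE, displayed BY NAME — «a self-equivalence
  `Ψ` of the model category over the identity of `D` arises, up to a base identification `η`, from a data automorphism»: there are `η` and a
  `DataAut (a, b)` with `Div(Ψ φ) = η_X^* a(Div φ)` and `u_{Ψ φ} = η_X^* b(u_φ)` for every arrow `φ`);
* **`TemperedFrobenioid.DivisorDataRigid C`** (THE rigidity input; print content ≙ commensurable terminality of the prime decomposition
  groups + cyclotomic rigidity [EtTh] Thm. 5.6 — FACT rows F-0526/F-0527 — + Prop. 5.3 — F-0561/F-0563/F-0564): EVERY data automorphism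
  over `id_D` is the identity;
* **`hrat_of_divisorDataRigid`** — `hrat` VERBATIM (L5's binder: `∀ Ψ` over `id_D`, `∃ η`, `hdiv ∧ hratio`) from these two; and the
  one-call corollary **`rigidOverBase_of_divisorDataRigid`** = `CatIsomorphism.RigidOverBase C.baseFunctorOfCategory` through p516053 §3 BY NAME
  (standing hypotheses `h`, `hsl`, `hfs`, `hnd`, `hz` displayed exactly as there).
HONEST LABEL: OUR kernel check that `RigidOverBase` holds at an [EtTh] Def. 3.6 carrier MODULO the displayed FACT-SHAPE Props
`SelfEquivInducesDataAut` ([FrdI] category-theoreticity) and `DivisorDataRigid` ([EtTh] rigidity) + the [FrdI] Thm. 5.2 inputs BY NAME; at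
`v̲` itself FOUNDATIONS-14 (L5's word).  REFUTABILITY FLAG of record (census, R1444): at DESIGN instances whose prime data carry a LEFT
`G`-action, `DivisorDataRigid` is FALSE (left translation by a non-central `g`), so `hrat`/`RigidOverBase` fail there AS TYPED; print is
not hit (double-coset primes).  Theorem-form only, no `instance`, no notation; nothing about [IUTchI] Cor. 5.3 / [EtTh] in print is
asserted; no side taken on [IUTchIII] Cor. 3.12; nothing here asserts abc proved or refuted; typed ≠ proved.
-/

noncomputable section

namespace Literature.AnabelianGeometry.EtaleTheta

open CategoryTheory Opposite Literature.AlgebraicGeometry.Frobenioids Literature.IUT.HodgeTheaters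

namespace TemperedFrobenioid

universe u₀ v₀ u v w

variable {D₀ : Type u₀} [Category.{v₀} D₀] {V : FrdIMonoidStub.{w}}
  {T : RealifiedDivisorMonoids (D₀ := D₀) V} {D : Type u} [Category.{v} D]
  {VD : FrdICatStub.{u, v, w} D} (C : TemperedFrobenioid T D VD)

/-! ## §1 Automorphisms of the Def. 3.6 data `(Φ, B, Div_B)` over `id_D` -/

/-- **An automorphism of the Def. 3.6 data `(D, Φ, B, B → Φ^gp)` over the identity of `D`**: monoid automorphisms `a_A` of every `Φ(A)`
and `b_A` of every `B(A)`, NATURAL with respect to every pull-back `Φ(f)`, `B(f)` (`f` an arrow of `D`), and compatible with `Div_B`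
(`Div_B (b_A u) = a_A^gp (Div_B u)`).  (In print's geometry a non-trivial such automorphism would permute the primes of every tempered
covering compatibly with all covering maps — excluded by commensurable terminality; at a DESIGN carrier with a left group action on the
prime data, left translation by any group element is one.) [cite: MochizukiEtTh2009, Def 3.6 p.303 (PDF p.77)] -/
structure DataAut where
  /-- the automorphism of the divisor monoid `Φ(A)` at every `A ∈ Ob(D)` -/
  a : ∀ A : Dᵒᵖ, (C.divisorMonoid.obj A : Type w) ≃* (C.divisorMonoid.obj A : Type w)
  /-- the automorphism of the rational-function monoid `B(A)` at every `A ∈ Ob(D)` -/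
  b : ∀ A : Dᵒᵖ, (C.ratFnFunctor.obj A : Type w) ≃* (C.ratFnFunctor.obj A : Type w)
  /-- naturality of `a` with respect to pull-back along every arrow of `D` -/
  a_natural : ∀ {A A' : D} (f : A ⟶ A') (x : C.divisorMonoid.obj (op A')),
    a (op A) (pull C.divisorMonoid f x) = pull C.divisorMonoid f (a (op A') x)
  /-- naturality of `b` with respect to pull-back along every arrow of `D` -/
  b_natural : ∀ {A A' : D} (f : A ⟶ A') (u : C.ratFnFunctor.obj (op A')),
    b (op A) (pull C.ratFnFunctor f u) = pull C.ratFnFunctor f (b (op A') u)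
  /-- compatibility with `Div_B : B → Φ^gp` -/
  divB_b : ∀ (A : Dᵒᵖ) (u : C.ratFnFunctor.obj A),
    Literature.AlgebraicGeometry.Frobenioids.divB C.divisorMonoid C.ratFnFunctor C.divBNatTrans A (b A u) =
      MonGp.map (a A).toMonoidHom (Literature.AlgebraicGeometry.Frobenioids.divB C.divisorMonoid C.ratFnFunctor C.divBNatTrans A u)

/-- The identity automorphism of the data. [cite: MochizukiEtTh2009, Def 3.6 p.303 (PDF p.77)] -/
def DataAut.refl : C.DataAut where
  a _ := MulEquiv.refl _
  b _ := MulEquiv.refl _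
  a_natural _ _ := rfl
  b_natural _ _ := rfl
  divB_b A u := by
    change _ = MonGp.map (MonoidHom.id _) _
    rw [MonGp.map_id]
    rfl

/-! ## §2 The two displayed FACT-SHAPE Props -/

/-- **«Every self-equivalence of the tempered Frobenioid over the identity of `D` arises, up to a base identification `η`, from a data
automorphism»** — the [FrdI] category-theoreticity SHAPE (Thm. 4.2 / Thm. 4.9: the divisor monoid is category-theoretic; Cor. 4.10 / 4.11:
so are the rational functions and `deg_Fr`), DISPLAYED BY NAME: for every self-equivalence `Ψ` of `C.category` with `Ψ ⋙ Base ≅ Base`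
there are `η : Ψ ⋙ Base ≅ Base` and a data automorphism `(a, b)` with `Div(Ψ φ) = η_X^* (a (Div φ))` and `u_{Ψ φ} = η_X^* (b (u_φ))`
for every arrow `φ : X → Y`. (FACT-SHAPE; not proved here.) [cite: MochizukiFrdI2008, Thm. 5.2 p.100] -/
def SelfEquivInducesDataAut : Prop :=
  ∀ Ψ : C.category ≌ C.category, Nonempty (Ψ.functor ⋙ C.baseFunctorOfCategory ≅ C.baseFunctorOfCategory) →
    ∃ η : Ψ.functor ⋙ C.baseFunctorOfCategory ≅ C.baseFunctorOfCategory, ∃ τ : C.DataAut,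
      (∀ ⦃X Y : C.category⦄ (φ : X ⟶ Y),
          ModelFrobenioid.div (Ψ.functor.map φ) =
            pull C.divisorMonoid (η.hom.app X : (Ψ.functor.obj X).base ⟶ X.base) (τ.a (op X.base) (ModelFrobenioid.div φ))) ∧
      (∀ ⦃X Y : C.category⦄ (φ : X ⟶ Y),
          ModelFrobenioid.unit (Ψ.functor.map φ) =
            pull C.ratFnFunctor (A := X.base) (B := (Ψ.functor.obj X).base) (η.hom.app X) (τ.b (op X.base) (ModelFrobenioid.unit φ)))

/-- **`DivisorDataRigid C` — THE rigidity input**: every automorphism of the Def. 3.6 data `(Φ, B, Div_B)` over `id_D` is the identity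
(both components, at every object).  Print content (honest): commensurable terminality of the decomposition groups of the primes +
cyclotomic rigidity [EtTh] Thm. 5.6 (FACT rows F-0526/F-0527) + Prop. 5.3 (F-0561/F-0563/F-0564); FALSE at design carriers whose prime
data carry a left group action (census flag, R1444). (FACT-SHAPE; not proved here.) [cite: MochizukiEtTh2009, Thm 5.6 p.328 (PDF p.102)] -/
def DivisorDataRigid : Prop :=
  ∀ τ : C.DataAut, (∀ (A : Dᵒᵖ) (x : C.divisorMonoid.obj A), τ.a A x = x) ∧ (∀ (A : Dᵒᵖ) (u : C.ratFnFunctor.obj A), τ.b A u = u)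

/-! ## §3 The law `hrat` of abc-iut-L5's `Cor53.tempered_rigidOverBase_of_divRatioRigid`, and `RigidOverBase` -/

/-- **L5's print-strength LAW `hrat` from the two displayed Props**: for every self-equivalence `Ψ` over the identity of `D` there is `η`
through which `Ψ` induces the identity on the divisor monoid (`hdiv`) and preserves the birational units of parallel linear arrows
(`hratio`) — because `Ψ` arises up to `η` from a data automorphism (`SelfEquivInducesDataAut`) and that automorphism is trivial
(`DivisorDataRigid`); `hratio` is then the commutativity of `B(A)`. Statement = L5's binder VERBATIM. [cite: MochizukiEtTh2009, Def 3.6 p.303 (PDF p.77)] -/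
theorem hrat_of_divisorDataRigid (hind : C.SelfEquivInducesDataAut) (hrig : C.DivisorDataRigid) :
    ∀ Ψ : C.category ≌ C.category,
      Nonempty (Ψ.functor ⋙ C.baseFunctorOfCategory ≅ C.baseFunctorOfCategory) →
      ∃ η : Ψ.functor ⋙ C.baseFunctorOfCategory ≅ C.baseFunctorOfCategory,
        (∀ ⦃X Y : C.category⦄ (φ : X ⟶ Y),
            ModelFrobenioid.div (Ψ.functor.map φ) =
              pull C.divisorMonoid (η.hom.app X : (Ψ.functor.obj X).base ⟶ X.base) (ModelFrobenioid.div φ)) ∧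
        (∀ ⦃X Y : C.category⦄ (f g : X ⟶ Y), ModelFrobenioid.degFr f = 1 →
            ModelFrobenioid.degFr g = 1 → ModelFrobenioid.baseMap f = ModelFrobenioid.baseMap g →
            ModelFrobenioid.unit (Ψ.functor.map f) *
                pull C.ratFnFunctor (A := X.base) (B := (Ψ.functor.obj X).base) (η.hom.app X) (ModelFrobenioid.unit g) =
              ModelFrobenioid.unit (Ψ.functor.map g) *
                pull C.ratFnFunctor (A := X.base) (B := (Ψ.functor.obj X).base) (η.hom.app X)
                  (ModelFrobenioid.unit f)) := by
  intro Ψ hΨ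
  obtain ⟨η, τ, hdiv, hunit⟩ := hind Ψ hΨ
  obtain ⟨ha, hb⟩ := hrig τ
  refine ⟨η, fun X Y φ => ?_, fun X Y f g _ _ _ => ?_⟩
  · rw [hdiv φ, ha]
  · rw [hunit f, hunit g, hb, hb, mul_comm]

/-- **`RigidOverBase (C.category → D)` — the [IUTchI] Cor 5.3 (iv) injectivity content AS TYPED by abc-iut-L5 (`CatIsomorphism.RigidOverBase`,
p495677) — at an [EtTh] Def. 3.6 tempered Frobenioid, MODULO the displayed {`SelfEquivInducesDataAut` ([FrdI]), `DivisorDataRigid`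
([EtTh])} and the [FrdI] Thm. 5.2 standing hypotheses BY NAME** (one call through abc-iut-L5-t4's ★ p516053 §3).
[cite: MochizukiEtTh2009, Def 3.6 p.303 (PDF p.77)] -/
theorem rigidOverBase_of_divisorDataRigid
    (h : ModelFrobenioid.Hypotheses C.divisorMonoid C.ratFnFunctor) (hsl : IsSlim D) (hfs : IsOfFSMFFType D)
    (hnd : IsNonDilatingOn C.divisorMonoid) (hz : ¬ ModelFrobenioid.IsZeroMonoid C.divisorMonoid)
    (hind : C.SelfEquivInducesDataAut) (hrig : C.DivisorDataRigid) :
    CatIsomorphism.RigidOverBase C.baseFunctorOfCategory :=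
  Cor53.tempered_rigidOverBase_of_divRatioRigid C h hsl hfs hnd hz (C.hrat_of_divisorDataRigid hind hrig)

end TemperedFrobenioid

end Literature.AnabelianGeometry.EtaleTheta

end
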